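import Literature.AlgebraicGeometry.Resolution.QuadraticTransforms
import HarnessLib

/-!
# Crux `Steer` (stmt-ResolutionOfSingularities-16345), chain W4.1 — RUNG programme for hG3, brick B1:
# THE O-FREE ARC OF A PERSISTENT CHAIN (the Shannon union modulo the x-adic infinitesimals is a DVR)

OURS (campaign `res-hironaka`, rung L ★L-G4, slot W4.1; seat res-L0-w41-stub-1 g4, res-L0-w41-plan-1 RULING 119e; blueprint
`L/res-L0-w41-stub-1/PERSIST-BLUEPRINT.md` 811204f015c0b400 §1 (L1) / §2 row B1). Statements about the route's own objects
(an increasing chain `S 0 ≤ S 1 ≤ ⋯` of LOCAL subrings of a field `L`, each dominated by the next — the chain currency of the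
G-words `NoEternalConstOrderIsolatedChainPerfect` / idea-3's `NoEternalPersistentChainPerfect`); they replace the role of no
printed item and are NOT statements of the manuscript under review [claim: Hironaka2017, status: under-review]; AI-produced,
weaker than expert review. Theses-free, definition-free, valuation-free, completion-free.

## The point

Along a PERSISTENT chain one element `x ∈ 𝔪_(S 0)` divides every non-unit of every member in the next member
(`hdiv : y ∈ 𝔪_(S m) ⇒ y = r · x`, `r ∈ S (m+1)` — the span clause plus persistence, res-type-062's
`PersistentChainValued.exists_eq_mul_excParam` / `exists_unit_mul_eq_of_persistent`). Then, WITHOUT any valuation: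

* §1–2 the union `V = ⋃ S m` (any subring `V` with `S m ≤ V` and `V ⊆ ⋃ S m`) is a LOCAL ring whose units are detected in
  every member (`isUnit_inclusion_iff`), `isLocalRing_union`, and `maximalIdeal V = (x)` (`maximalIdeal_union_eq_span`);
* §3 in a local DOMAIN with principal maximal ideal `(x)`: every element outside `P∞ := ⋂ₙ (xⁿ)` is `xⁿ · unit`
  (`exists_pow_mul_isUnit_of_not_forall_mem`), `P∞` is PRIME and misses `x` (`isPrime_of_forall_mem_iff`,
  `not_mem_of_forall_mem_iff`), and `V ⧸ P∞` is a DISCRETE VALUATION RING with uniformiser `x̄`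
  (`isDiscreteValuationRing_quotient`) — the O-free ARC of the chain;
* §4 the arc maps `θ m : S m → V ⧸ P∞` (quotient ∘ inclusion) are LOCAL (`isUnit_of_isUnit_arc`), send `𝔪_(S m)` into `(x̄)`
  (`arc_mem_span_of_mem_maximalIdeal`), are compatible along the chain (`arc_inclusion`), and — when every centre is RATIONAL
  (`hrat`: residues of `S (m+1)` come from `S m`) — every element of `V ⧸ P∞` is a residue from `S 0` modulo `x̄`
  (`exists_sub_arc_mem_span_of_rational`).

Next bricks (blueprint B2, B3): telescoped law + derivation growth, completed arc. [cite: HeinzerEtAl2015, §1] [folklore]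
-/

noncomputable section

-- `Summit.<S>.<S>.…` duplicates the summit name by design (single-problem summit).
set_option linter.dupNamespace false
set_option autoImplicit false

namespace Summit.ResolutionOfSingularities.ResolutionOfSingularities.Theorems.SwitchingDichotomy.PersistentArc

open IsLocalRing
open Literature.AlgebraicGeometry.Resolution

variable {L : Type} [Field L]

/-! ## §1 Domination along the chain: inverses found later are already there -/

section Chain

variable {S : ℕ → Subring L}

/-- Successive domination is transitive along the chain. [folklore] -/
theorem subringDominates_of_le (hdom : ∀ m, SubringDominates (S m) (S (m + 1))) {m n : ℕ} (hmn : m ≤ n) :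
    SubringDominates (S m) (S n) := by
  induction hmn with
  | refl => exact SubringDominates.refl _
  | step _ ih => exact ih.trans (hdom _)

/-- A successively dominated chain is monotone. [folklore] -/
theorem monotone_of_dominates (hdom : ∀ m, SubringDominates (S m) (S (m + 1))) : Monotone S :=
  monotone_nat_of_le_succ fun m => (hdom m).1

/-- An inverse found anywhere along the chain already lies in the member. [folklore] -/
theorem inv_mem_of_inv_mem (hdom : ∀ m, SubringDominates (S m) (S (m + 1))) {m n : ℕ} {y : L}
    (hy : y ∈ S m) (hinv : y⁻¹ ∈ S n) : y⁻¹ ∈ S m := by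
  rcases le_total m n with hmn | hnm
  · exact (subringDominates_of_le hdom hmn).2 y hy hinv
  · exact monotone_of_dominates hdom hnm hinv

end Chain

/-! ## §2 The union is local with principal maximal ideal -/

section Union

variable {S : ℕ → Subring L} {V : Subring L}

/-- Units of the union are detected in every member. [folklore] -/
theorem isUnit_inclusion_iff (hdom : ∀ m, SubringDominates (S m) (S (m + 1))) (hSV : ∀ m, S m ≤ V)
    (hVS : ∀ a ∈ V, ∃ m, a ∈ S m) {m : ℕ} (y : S m) :
    IsUnit (Subring.inclusion (hSV m) y) ↔ IsUnit y := by
  rw [isUnit_subring_iff_inv_mem, isUnit_subring_iff_inv_mem]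
  change (y : L) ≠ 0 ∧ (y : L)⁻¹ ∈ V ↔ (y : L) ≠ 0 ∧ (y : L)⁻¹ ∈ S m
  constructor
  · rintro ⟨h0, hinv⟩
    obtain ⟨n, hn⟩ := hVS _ hinv
    exact ⟨h0, inv_mem_of_inv_mem hdom y.2 hn⟩
  · rintro ⟨h0, hinv⟩
    exact ⟨h0, hSV m hinv⟩

/-- **The union of a successively dominated chain of local subrings is local.** [folklore] -/
theorem isLocalRing_union [∀ m, IsLocalRing (S m)] (hdom : ∀ m, SubringDominates (S m) (S (m + 1)))
    (hSV : ∀ m, S m ≤ V) (hVS : ∀ a ∈ V, ∃ m, a ∈ S m) : IsLocalRing V := by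
  refine IsLocalRing.of_nonunits_add fun a b ha hb => ?_
  obtain ⟨m, ham⟩ := hVS a a.2
  obtain ⟨n, hbn⟩ := hVS b b.2
  have hak : (a : L) ∈ S (max m n) := monotone_of_dominates hdom (le_max_left m n) ham
  have hbk : (b : L) ∈ S (max m n) := monotone_of_dominates hdom (le_max_right m n) hbn
  intro hab
  have hab' : IsUnit (⟨(a : L) + b, (S (max m n)).add_mem hak hbk⟩ : S (max m n)) := by
    rw [← isUnit_inclusion_iff hdom hSV hVS]
    exact hab
  rcases IsLocalRing.isUnit_or_isUnit_of_isUnit_add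
      (show IsUnit ((⟨(a : L), hak⟩ : S (max m n)) + ⟨(b : L), hbk⟩) from hab') with hau | hbu
  · exact ha ((isUnit_inclusion_iff hdom hSV hVS (⟨(a : L), hak⟩ : S (max m n))).mpr hau)
  · exact hb ((isUnit_inclusion_iff hdom hSV hVS (⟨(b : L), hbk⟩ : S (max m n))).mpr hbu)

/-- A non-unit of a member is a non-unit of the union. [folklore] -/
theorem inclusion_mem_maximalIdeal [∀ m, IsLocalRing (S m)] [IsLocalRing V]
    (hdom : ∀ m, SubringDominates (S m) (S (m + 1))) (hSV : ∀ m, S m ≤ V) (hVS : ∀ a ∈ V, ∃ m, a ∈ S m)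
    {m : ℕ} {y : S m} (hy : y ∈ maximalIdeal (S m)) : Subring.inclusion (hSV m) y ∈ maximalIdeal V := by
  rw [IsLocalRing.mem_maximalIdeal, mem_nonunits_iff] at hy ⊢
  rwa [isUnit_inclusion_iff hdom hSV hVS]

/-- A non-unit of the union lying in a member is a non-unit there. [folklore] -/
theorem mem_maximalIdeal_of_inclusion_mem [∀ m, IsLocalRing (S m)] [IsLocalRing V]
    (hdom : ∀ m, SubringDominates (S m) (S (m + 1))) (hSV : ∀ m, S m ≤ V) (hVS : ∀ a ∈ V, ∃ m, a ∈ S m)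
    {m : ℕ} {y : S m} (hy : Subring.inclusion (hSV m) y ∈ maximalIdeal V) : y ∈ maximalIdeal (S m) := by
  rw [IsLocalRing.mem_maximalIdeal, mem_nonunits_iff] at hy ⊢
  rwa [← isUnit_inclusion_iff hdom hSV hVS]

/-- **The maximal ideal of the union is principal**, generated by the persistent parameter `x`: every non-unit of
every member is `x` times an element of the next member. [folklore] -/
theorem maximalIdeal_union_eq_span [∀ m, IsLocalRing (S m)] [IsLocalRing V]
    (hdom : ∀ m, SubringDominates (S m) (S (m + 1))) (hSV : ∀ m, S m ≤ V) (hVS : ∀ a ∈ V, ∃ m, a ∈ S m)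
    {x : L} (hx0 : x ∈ S 0) (hxm : (⟨x, hx0⟩ : S 0) ∈ maximalIdeal (S 0))
    (hdiv : ∀ m (y : S m), y ∈ maximalIdeal (S m) → ∃ r ∈ S (m + 1), (y : L) = r * x) :
    maximalIdeal V = Ideal.span {(⟨x, hSV 0 hx0⟩ : V)} := by
  apply le_antisymm
  · intro a ha
    obtain ⟨m, ham⟩ := hVS a a.2
    have ham' : (⟨(a : L), ham⟩ : S m) ∈ maximalIdeal (S m) :=
      mem_maximalIdeal_of_inclusion_mem hdom hSV hVS (y := ⟨(a : L), ham⟩) (by exact ha)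
    obtain ⟨r, hr, hra⟩ := hdiv m ⟨(a : L), ham⟩ ham'
    refine Ideal.mem_span_singleton.mpr ⟨⟨r, hSV (m + 1) hr⟩, Subtype.ext ?_⟩
    change (a : L) = x * r
    rw [mul_comm]; exact hra
  · rw [Ideal.span_le, Set.singleton_subset_iff]
    exact inclusion_mem_maximalIdeal hdom hSV hVS hxm

end Union

/-! ## §3 A local domain with principal maximal ideal: the x-adic infinitesimals form a prime, the quotient is a DVR -/

section Principal

variable {V : Type} [CommRing V] [IsDomain V] [IsLocalRing V] {x : V}

omit [IsLocalRing V] in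
/-- In a domain, `xⁿ ∉ (xⁿ⁺¹)` for a non-unit `x ≠ 0`. [folklore] -/
theorem pow_not_mem_span_pow_succ (hx0 : x ≠ 0) (hxu : ¬ IsUnit x) (n : ℕ) :
    x ^ n ∉ Ideal.span {x ^ (n + 1)} := by
  intro h
  obtain ⟨c, hc⟩ := Ideal.mem_span_singleton'.mp h
  -- `c * x^(n+1) = x^n` ⇒ `x * c = 1`
  have : x ^ n * (x * c) = x ^ n * 1 := by
    calc x ^ n * (x * c) = c * x ^ (n + 1) := by ring
      _ = x ^ n := hc
      _ = x ^ n * 1 := (mul_one _).symm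
  have hcx : x * c = 1 := mul_left_cancel₀ (pow_ne_zero n hx0) this
  exact hxu (isUnit_of_dvd_one ⟨c, hcx.symm⟩)

omit [IsDomain V] in
/-- **Structure of a local ring with principal maximal ideal `(x)`:** an element not divisible by every power of `x` is
`xⁿ · unit`. [folklore] -/
theorem exists_pow_mul_isUnit_of_not_forall_mem (hmax : maximalIdeal V = Ideal.span {x}) (a : V)
    (ha : ¬ ∀ n : ℕ, a ∈ Ideal.span {x ^ n}) : ∃ (n : ℕ) (u : V), IsUnit u ∧ a = x ^ n * u := by
  classical
  push Not at ha
  let N := Nat.find ha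
  have hN : a ∉ Ideal.span {x ^ N} := Nat.find_spec ha
  have hN0 : N ≠ 0 := by
    intro h
    apply hN
    rw [h, pow_zero, Ideal.span_singleton_one]
    exact Submodule.mem_top
  obtain ⟨n, hn⟩ := Nat.exists_eq_succ_of_ne_zero hN0
  have hmem : a ∈ Ideal.span {x ^ n} := by
    by_contra h
    have := Nat.find_min ha (show n < N by omega)
    exact this h
  obtain ⟨u, hu⟩ := Ideal.mem_span_singleton'.mp hmem
  refine ⟨n, u, ?_, by rw [← hu, mul_comm]⟩
  by_contra hunit
  have humem : u ∈ maximalIdeal V := (IsLocalRing.mem_maximalIdeal u).mpr hunit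
  rw [hmax] at humem
  obtain ⟨c, hc⟩ := Ideal.mem_span_singleton'.mp humem
  apply hN
  rw [hn]
  refine Ideal.mem_span_singleton'.mpr ⟨c, ?_⟩
  calc c * x ^ (n + 1) = (c * x) * x ^ n := by ring
    _ = u * x ^ n := by rw [hc]
    _ = a := hu

omit [IsDomain V] in
/-- `x` is not a unit when `(x)` is the maximal ideal. [folklore] -/
theorem not_isUnit_of_maximalIdeal_eq_span (hmax : maximalIdeal V = Ideal.span {x}) : ¬ IsUnit x := by
  have : x ∈ maximalIdeal V := by rw [hmax]; exact Ideal.mem_span_singleton_self x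
  exact (IsLocalRing.mem_maximalIdeal x).mp this

/-- **The x-adic infinitesimals `P∞ = ⋂ₙ (xⁿ)` form a PRIME ideal.** [folklore] -/
theorem isPrime_of_forall_mem_iff (hmax : maximalIdeal V = Ideal.span {x}) (hx0 : x ≠ 0) {P : Ideal V}
    (hP : ∀ a : V, a ∈ P ↔ ∀ n : ℕ, a ∈ Ideal.span {x ^ n}) : P.IsPrime := by
  have hxu := not_isUnit_of_maximalIdeal_eq_span hmax
  refine ⟨?_, ?_⟩
  · intro htop
    have h1 : (1 : V) ∈ Ideal.span {x ^ 1} := (hP 1).mp (by rw [htop]; exact Submodule.mem_top) 1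
    rw [pow_one] at h1
    exact hxu (isUnit_of_dvd_one (Ideal.mem_span_singleton.mp h1))
  · intro a b hab
    by_contra hne
    push Not at hne
    obtain ⟨n, u, hu, rfl⟩ := exists_pow_mul_isUnit_of_not_forall_mem hmax a (fun h => hne.1 ((hP a).mpr h))
    obtain ⟨k, v, hv, rfl⟩ := exists_pow_mul_isUnit_of_not_forall_mem hmax b (fun h => hne.2 ((hP b).mpr h))
    have hmem : x ^ n * u * (x ^ k * v) ∈ Ideal.span {x ^ (n + k + 1)} := (hP _).mp hab (n + k + 1)
    obtain ⟨c, hc⟩ := Ideal.mem_span_singleton'.mp hmem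
    have : x ^ (n + k) * (u * v) = x ^ (n + k) * (x * c) := by
      calc x ^ (n + k) * (u * v) = x ^ n * u * (x ^ k * v) := by ring
        _ = c * x ^ (n + k + 1) := hc.symm
        _ = x ^ (n + k) * (x * c) := by ring
    have huv : u * v = x * c := mul_left_cancel₀ (pow_ne_zero _ hx0) this
    exact hxu (isUnit_of_dvd_unit ⟨c, huv⟩ (hu.mul hv))

/-- `x ∉ P∞`. [folklore] -/
theorem not_mem_of_forall_mem_iff (hmax : maximalIdeal V = Ideal.span {x}) (hx0 : x ≠ 0) {P : Ideal V}
    (hP : ∀ a : V, a ∈ P ↔ ∀ n : ℕ, a ∈ Ideal.span {x ^ n}) : x ∉ P := by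
  intro h
  have := (hP x).mp h 2
  exact pow_not_mem_span_pow_succ hx0 (not_isUnit_of_maximalIdeal_eq_span hmax) 1 (by simpa using this)

omit [IsDomain V] in
/-- `P∞` lies inside every power `(xⁿ)`, in particular inside the maximal ideal. [folklore] -/
theorem le_maximalIdeal_of_forall_mem_iff (hmax : maximalIdeal V = Ideal.span {x}) {P : Ideal V}
    (hP : ∀ a : V, a ∈ P ↔ ∀ n : ℕ, a ∈ Ideal.span {x ^ n}) : P ≤ maximalIdeal V := by
  intro a ha
  rw [hmax]
  simpa using (hP a).mp ha 1

omit [IsDomain V] in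
/-- Units modulo `P∞` lift: if the class of `a` is a unit of `V ⧸ P∞` then `a` is a unit. [folklore] -/
theorem isUnit_of_isUnit_mk (hmax : maximalIdeal V = Ideal.span {x}) {P : Ideal V}
    (hP : ∀ a : V, a ∈ P ↔ ∀ n : ℕ, a ∈ Ideal.span {x ^ n}) {a : V} (ha : IsUnit (Ideal.Quotient.mk P a)) :
    IsUnit a := by
  obtain ⟨b', hb'⟩ := ha.exists_right_inv
  obtain ⟨b, rfl⟩ := Ideal.Quotient.mk_surjective b'
  rw [← map_mul, ← map_one (Ideal.Quotient.mk P), Ideal.Quotient.eq] at hb'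
  have hm : a * b - 1 ∈ maximalIdeal V := le_maximalIdeal_of_forall_mem_iff hmax hP hb'
  -- `a * b = 1 + m` with `m ∈ 𝔪` is a unit
  have hab : IsUnit (a * b) := by
    by_contra h
    have hab' : a * b ∈ maximalIdeal V := (IsLocalRing.mem_maximalIdeal _).mpr h
    have h1 : (1 : V) ∈ maximalIdeal V := by
      have := Ideal.sub_mem _ hab' hm
      rwa [sub_sub_cancel] at this
    exact (IsLocalRing.maximalIdeal.isMaximal V).ne_top (Ideal.eq_top_of_isUnit_mem _ h1 isUnit_one)
  exact isUnit_of_mul_isUnit_left hab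

/-- The class of `x` modulo `P∞` is IRREDUCIBLE. [folklore] -/
theorem irreducible_mk (hmax : maximalIdeal V = Ideal.span {x}) (hx0 : x ≠ 0) {P : Ideal V}
    (hP : ∀ a : V, a ∈ P ↔ ∀ n : ℕ, a ∈ Ideal.span {x ^ n}) : Irreducible (Ideal.Quotient.mk P x) := by
  have hxu := not_isUnit_of_maximalIdeal_eq_span hmax
  have hxP := not_mem_of_forall_mem_iff hmax hx0 hP
  refine ⟨fun h => hxu (isUnit_of_isUnit_mk hmax hP h), fun a' b' hab => ?_⟩
  obtain ⟨a, rfl⟩ := Ideal.Quotient.mk_surjective a'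
  obtain ⟨b, rfl⟩ := Ideal.Quotient.mk_surjective b'
  have haP : a ∉ P := fun haP => hxP (Ideal.Quotient.eq_zero_iff_mem.mp (by
    rw [hab, Ideal.Quotient.eq_zero_iff_mem.mpr haP, zero_mul]))
  have hbP : b ∉ P := fun hbP => hxP (Ideal.Quotient.eq_zero_iff_mem.mp (by
    rw [hab, Ideal.Quotient.eq_zero_iff_mem.mpr hbP, mul_zero]))
  obtain ⟨n, u, hu, rfl⟩ := exists_pow_mul_isUnit_of_not_forall_mem hmax a (fun h => haP ((hP a).mpr h))
  obtain ⟨k, v, hv, rfl⟩ := exists_pow_mul_isUnit_of_not_forall_mem hmax b (fun h => hbP ((hP b).mpr h))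
  -- `x - x^(n+k) u v ∈ P ⊆ (x^(n+k+1))`
  rw [← map_mul, Ideal.Quotient.eq] at hab
  have hmem : x - x ^ n * u * (x ^ k * v) ∈ Ideal.span {x ^ (n + k + 1)} := (hP _).mp hab _
  by_cases hn : n = 0
  · subst hn; left; rw [pow_zero, one_mul]; exact hu.map _
  by_cases hk : k = 0
  · subst hk; right; rw [pow_zero, one_mul]; exact hv.map _
  exfalso
  obtain ⟨c, hc⟩ := Ideal.mem_span_singleton'.mp hmem
  obtain ⟨j, hj⟩ : ∃ j, n + k = j + 2 := ⟨n + k - 2, by omega⟩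
  have key : x * 1 = x * (x ^ (j + 1) * (u * v + x * c)) := by
    calc x * 1 = (x - x ^ n * u * (x ^ k * v)) + x ^ n * u * (x ^ k * v) := by ring
      _ = c * x ^ (n + k + 1) + x ^ (n + k) * (u * v) := by rw [hc]; ring
      _ = x * (x ^ (j + 1) * (u * v + x * c)) := by rw [hj]; ring
  have h1 : (1 : V) = x ^ (j + 1) * (u * v + x * c) := mul_left_cancel₀ hx0 key
  exact hxu (isUnit_of_dvd_one ⟨x ^ j * (u * v + x * c), by rw [h1]; ring⟩)

omit [IsDomain V] in
/-- Every non-zero class modulo `P∞` is a power of the class of `x` times a unit. [folklore] -/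
theorem exists_associated_pow_mk (hmax : maximalIdeal V = Ideal.span {x}) {P : Ideal V}
    (hP : ∀ a : V, a ∈ P ↔ ∀ n : ℕ, a ∈ Ideal.span {x ^ n}) {z : V ⧸ P} (hz : z ≠ 0) :
    ∃ n : ℕ, Associated (Ideal.Quotient.mk P x ^ n) z := by
  obtain ⟨z, rfl⟩ := Ideal.Quotient.mk_surjective z
  have hzP : z ∉ P := fun h => hz (Ideal.Quotient.eq_zero_iff_mem.mpr h)
  obtain ⟨n, u, hu, rfl⟩ := exists_pow_mul_isUnit_of_not_forall_mem hmax z (fun h => hzP ((hP z).mpr h))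
  refine ⟨n, (hu.map (Ideal.Quotient.mk P)).unit, ?_⟩
  rw [IsUnit.unit_spec, map_mul, map_pow]

/-- **The O-free arc is a DVR**: `V ⧸ P∞` is a discrete valuation ring (uniformiser the class of `x`). [folklore] -/
theorem isDiscreteValuationRing_quotient (hmax : maximalIdeal V = Ideal.span {x}) (hx0 : x ≠ 0) {P : Ideal V}
    (hP : ∀ a : V, a ∈ P ↔ ∀ n : ℕ, a ∈ Ideal.span {x ^ n}) [P.IsPrime] :
    IsDiscreteValuationRing (V ⧸ P) :=
  IsDiscreteValuationRing.ofHasUnitMulPowIrreducibleFactorization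
    ⟨Ideal.Quotient.mk P x, irreducible_mk hmax hx0 hP, fun hz => exists_associated_pow_mk hmax hP hz⟩

/-- The maximal ideal of the arc is generated by the class of `x`. [folklore] -/
theorem maximalIdeal_quotient_eq_span (hmax : maximalIdeal V = Ideal.span {x}) (hx0 : x ≠ 0) {P : Ideal V}
    (hP : ∀ a : V, a ∈ P ↔ ∀ n : ℕ, a ∈ Ideal.span {x ^ n}) [P.IsPrime] :
    @maximalIdeal (V ⧸ P) _ (isDiscreteValuationRing_quotient hmax hx0 hP).toIsLocalRing
      = Ideal.span {Ideal.Quotient.mk P x} := by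
  letI := isDiscreteValuationRing_quotient hmax hx0 hP
  exact (irreducible_mk hmax hx0 hP).maximalIdeal_eq

end Principal

/-! ## §4 The arc on the chain: local, compatible, uniformiser `x̄`, residues from `S 0` under rationality -/

section Arc

variable {S : ℕ → Subring L} {V : Subring L}

/-- The arc maps `S m → V ⧸ P∞` (quotient ∘ inclusion) are COMPATIBLE along the chain. [folklore] -/
theorem arc_inclusion (hSV : ∀ m, S m ≤ V) (P : Ideal V) {m n : ℕ} (hmn : S m ≤ S n) (y : S m) :
    ((Ideal.Quotient.mk P).comp (Subring.inclusion (hSV n))) (Subring.inclusion hmn y)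
      = ((Ideal.Quotient.mk P).comp (Subring.inclusion (hSV m))) y := rfl

/-- The arc of `x ∈ S 0` is the class of `x`. [folklore] -/
theorem arc_self (hSV : ∀ m, S m ≤ V) (P : Ideal V) {x : L} (hx0 : x ∈ S 0) :
    ((Ideal.Quotient.mk P).comp (Subring.inclusion (hSV 0))) ⟨x, hx0⟩ = Ideal.Quotient.mk P ⟨x, hSV 0 hx0⟩ := rfl

/-- **The arc is LOCAL**: a member element whose class modulo `P∞` is a unit is a unit of the member. [folklore] -/
theorem isUnit_of_isUnit_arc [∀ m, IsLocalRing (S m)] [IsLocalRing V]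
    (hdom : ∀ m, SubringDominates (S m) (S (m + 1))) (hSV : ∀ m, S m ≤ V) (hVS : ∀ a ∈ V, ∃ m, a ∈ S m)
    {x : L} (hx0 : x ∈ S 0) (hmax : maximalIdeal V = Ideal.span {(⟨x, hSV 0 hx0⟩ : V)}) {P : Ideal V}
    (hP : ∀ a : V, a ∈ P ↔ ∀ n : ℕ, a ∈ Ideal.span {(⟨x, hSV 0 hx0⟩ : V) ^ n})
    {m : ℕ} {y : S m} (hy : IsUnit (((Ideal.Quotient.mk P).comp (Subring.inclusion (hSV m))) y)) : IsUnit y :=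
  (isUnit_inclusion_iff hdom hSV hVS y).mp (isUnit_of_isUnit_mk hmax hP hy)

/-- The arc sends the maximal ideal of a member into `(x̄)`. [folklore] -/
theorem arc_mem_span_of_mem_maximalIdeal [∀ m, IsLocalRing (S m)] (hSV : ∀ m, S m ≤ V) {x : L} (hx0 : x ∈ S 0)
    (P : Ideal V) (hdiv : ∀ m (y : S m), y ∈ maximalIdeal (S m) → ∃ r ∈ S (m + 1), (y : L) = r * x)
    {m : ℕ} {y : S m} (hy : y ∈ maximalIdeal (S m)) :
    ((Ideal.Quotient.mk P).comp (Subring.inclusion (hSV m))) y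
      ∈ Ideal.span {Ideal.Quotient.mk P ⟨x, hSV 0 hx0⟩} := by
  obtain ⟨r, hr, hyr⟩ := hdiv m y hy
  refine Ideal.mem_span_singleton.mpr ⟨Ideal.Quotient.mk P ⟨r, hSV (m + 1) hr⟩, ?_⟩
  rw [RingHom.comp_apply, ← map_mul]
  congr 1
  exact Subtype.ext (by simpa [mul_comm] using hyr)

/-- RATIONAL centres (`hrat`: every residue of `S (m+1)` comes from `S m`): every element of the union is congruent to
an element of `S 0` modulo the maximal ideal. [folklore] -/
theorem exists_sub_inclusion_mem_maximalIdeal_of_rational [∀ m, IsLocalRing (S m)] [IsLocalRing V]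
    (hdom : ∀ m, SubringDominates (S m) (S (m + 1))) (hSV : ∀ m, S m ≤ V) (hVS : ∀ a ∈ V, ∃ m, a ∈ S m)
    (hrat : ∀ m (z : S (m + 1)), ∃ y : S m, z - Subring.inclusion (hdom m).1 y ∈ maximalIdeal (S (m + 1)))
    (a : V) : ∃ y : S 0, a - Subring.inclusion (hSV 0) y ∈ maximalIdeal V := by
  suffices h : ∀ (m : ℕ) (z : S m),
      ∃ y : S 0, Subring.inclusion (hSV m) z - Subring.inclusion (hSV 0) y ∈ maximalIdeal V by
    obtain ⟨m, ham⟩ := hVS a a.2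
    exact h m ⟨a, ham⟩
  intro m
  induction m with
  | zero => intro z; exact ⟨z, by simp⟩
  | succ m ih =>
    intro z
    obtain ⟨y', hy'⟩ := hrat m z
    obtain ⟨y, hy⟩ := ih y'
    refine ⟨y, ?_⟩
    have h1 : Subring.inclusion (hSV (m + 1)) z - Subring.inclusion (hSV m) y' ∈ maximalIdeal V := by
      have := inclusion_mem_maximalIdeal hdom hSV hVS hy'
      rw [map_sub] at this
      exact this
    have := Ideal.add_mem _ h1 hy
    rwa [sub_add_sub_cancel] at this

/-- RATIONAL centres: every element of the arc `V ⧸ P∞` is the class of an element of `S 0` modulo the uniformiser `x̄`.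
[folklore] -/
theorem exists_sub_arc_mem_span_of_rational [∀ m, IsLocalRing (S m)] [IsLocalRing V]
    (hdom : ∀ m, SubringDominates (S m) (S (m + 1))) (hSV : ∀ m, S m ≤ V) (hVS : ∀ a ∈ V, ∃ m, a ∈ S m)
    {x : L} (hx0 : x ∈ S 0) (hmax : maximalIdeal V = Ideal.span {(⟨x, hSV 0 hx0⟩ : V)}) (P : Ideal V)
    (hrat : ∀ m (z : S (m + 1)), ∃ y : S m, z - Subring.inclusion (hdom m).1 y ∈ maximalIdeal (S (m + 1)))
    (a : V ⧸ P) : ∃ y : S 0, a - ((Ideal.Quotient.mk P).comp (Subring.inclusion (hSV 0))) y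
      ∈ Ideal.span {Ideal.Quotient.mk P ⟨x, hSV 0 hx0⟩} := by
  obtain ⟨a, rfl⟩ := Ideal.Quotient.mk_surjective a
  obtain ⟨y, hy⟩ := exists_sub_inclusion_mem_maximalIdeal_of_rational hdom hSV hVS hrat a
  refine ⟨y, ?_⟩
  rw [hmax] at hy
  obtain ⟨c, hc⟩ := Ideal.mem_span_singleton.mp hy
  refine Ideal.mem_span_singleton.mpr ⟨Ideal.Quotient.mk P c, ?_⟩
  rw [RingHom.comp_apply, ← map_sub, hc, map_mul]

end Arc

end Summit.ResolutionOfSingularities.ResolutionOfSingularities.Theorems.SwitchingDichotomy.PersistentArc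

end
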